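import Summits.AnomalousDissipation.AnomalousDissipation.Theorems.SawtoothPulseCascadeK1LocalisedCascadeKHForcingClosedForm

/-!
# K2 lane (route-2 `SawtoothPulseCascade`, crux dir `K1LocalisedCascade`): the forcing of a finite MODE PROFILE is the coefficient-weighted sum of single-mode sources

Sequel of `…KHForcingPieces` / `…KHForcingClosedForm` (ACL item stmt-AnomalousDissipation-19491; S2-cert forced part). p4's typed phase map feeds the sheet block
with interior content `modeProfile β K c = Σ_{n ∈ win K} c n · e^{2πi(β+n)y}` (`K2ConeSketch.lean` §2, `hFresh`/`vFresh`); the source it induces on a kink line is,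
by linearity of the integral, `Σ_n c n · src(y₀, β+n, s)` — provided each single-mode integrand is integrable, which this file records:
* `forcingIntegrand_intervalIntegrable_quarter/negQuarter`: `y ↦ G(y₀ − y) e^{2πiξy} e^{−2πi a s T(y)}` is interval integrable on `[−½, ½]` (`y₀ = ±¼`);
* `integral_forcing_finset_sum`: `∫_{−½}^{½} G(y₀−y)·(Σ_{n∈S} c n e^{2πi(β+n)y})·e^{−2πiasT(y)} dy = Σ_{n∈S} c n · ∫_{−½}^{½} G(y₀−y) e^{2πi(β+n)y} e^{−2πiasT(y)} dy`
  for every finite `S` and both kink lines (each summand then has the closed form of `forcing_src_quarter` / `forcing_src_negQuarter` with `ξ = β + n`).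
No definitions; no statement about the crux. [cite: Drazin2002, §8.3 (8.36)–(8.38)] [problem: turb]
-/

-- `Summit.<Summit>.<Problem>`: single-conjunct summit, the duplicate namespace segment is deliberate.
set_option linter.dupNamespace false

noncomputable section

namespace Summit.AnomalousDissipation.AnomalousDissipation.Theorems.SawtoothPulseCascade.K2PhaseBudget

open Set MeasureTheory intervalIntegral Literature.Analysis.FluidPDE.SawtoothCascade

section modes

variable {a : ℝ} {K G : ℝ → ℂ}

/-- The single-mode forcing integrand at the kink line `y₀ = ¼` is interval integrable on `[−½, ½]` (piecewise equal on the open pieces to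
continuous functions, `…KHForcingPieces`). [cite: Drazin2002, §8.3 (8.36)–(8.38)] -/
theorem forcingIntegrand_intervalIntegrable_quarter (ha : 0 < a) (β ξ s : ℝ)
    (hK : K = fun r : ℝ => (-((Real.exp (-(2 * Real.pi * a * r)) : ℂ) /
            (1 - starRingEnd ℂ (Complex.exp (2 * Real.pi * β * Complex.I)) * (Real.exp (-(2 * Real.pi * a)) : ℂ))
          + (Real.exp (2 * Real.pi * a * (r - 1)) : ℂ) * Complex.exp (2 * Real.pi * β * Complex.I) /
            (1 - Complex.exp (2 * Real.pi * β * Complex.I) * (Real.exp (-(2 * Real.pi * a)) : ℂ))) /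
        (2 * (2 * Real.pi * a) : ℂ)))
    (hG : ∀ u : ℝ, G u = Complex.exp (2 * Real.pi * β * (⌊u⌋ : ℝ) * Complex.I) * K (u - ⌊u⌋)) :
    IntervalIntegrable (fun y : ℝ => G ((1 / 4 : ℝ) - y) * Complex.exp (((2 * Real.pi * ξ * y : ℝ) : ℂ) * Complex.I) * Complex.exp (-((2 * Real.pi * a * s * triWave y : ℝ) : ℂ) * Complex.I)) volume (-(1 / 2 : ℝ)) (1 / 2 : ℝ) := by
  set F : ℝ → ℂ := fun y => G ((1 / 4 : ℝ) - y) * Complex.exp (((2 * Real.pi * ξ * y : ℝ) : ℂ) * Complex.I) * Complex.exp (-((2 * Real.pi * a * s * triWave y : ℝ) : ℂ) * Complex.I) with hF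
  have P0 : IntervalIntegrable F volume (-(1 / 2 : ℝ)) (-(1 / 4 : ℝ)) := by
    have hEq : EqOn F (fun y : ℝ => Complex.exp (((Real.pi * a * s : ℝ) : ℂ) * Complex.I) * ((((1 : ℂ) * (-1 / ((1 - starRingEnd ℂ (Complex.exp (2 * Real.pi * β * Complex.I)) * (Real.exp (-(2 * Real.pi * a)) : ℂ)) * (2 * (2 * Real.pi * a)))) * Complex.exp (-((2 * Real.pi * a : ℝ) : ℂ) * (1 / 4 : ℝ))) * Complex.exp (((2 * Real.pi * a : ℝ) : ℂ) * y) + ((1 : ℂ) * (-(Complex.exp (2 * Real.pi * β * Complex.I) * (Real.exp (-(2 * Real.pi * a)) : ℂ)) / ((1 - Complex.exp (2 * Real.pi * β * Complex.I) * (Real.exp (-(2 * Real.pi * a)) : ℂ)) * (2 * (2 * Real.pi * a)))) * Complex.exp (((2 * Real.pi * a : ℝ) : ℂ) * (1 / 4 : ℝ))) * Complex.exp (-((2 * Real.pi * a : ℝ) : ℂ) * y)) *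
        Complex.exp (((((2 * Real.pi * (ξ + a * s) : ℝ)) : ℂ)) * y * Complex.I))) (Ioo (-(1 / 2 : ℝ)) (-(1 / 4 : ℝ))) := fun y hy => by
      simp only [hF]; exact forcingIntegrand_quarter_trough ha β ξ s hK hG hy
    have hc : Continuous (fun y : ℝ => Complex.exp (((Real.pi * a * s : ℝ) : ℂ) * Complex.I) * ((((1 : ℂ) * (-1 / ((1 - starRingEnd ℂ (Complex.exp (2 * Real.pi * β * Complex.I)) * (Real.exp (-(2 * Real.pi * a)) : ℂ)) * (2 * (2 * Real.pi * a)))) * Complex.exp (-((2 * Real.pi * a : ℝ) : ℂ) * (1 / 4 : ℝ))) * Complex.exp (((2 * Real.pi * a : ℝ) : ℂ) * y) + ((1 : ℂ) * (-(Complex.exp (2 * Real.pi * β * Complex.I) * (Real.exp (-(2 * Real.pi * a)) : ℂ)) / ((1 - Complex.exp (2 * Real.pi * β * Complex.I) * (Real.exp (-(2 * Real.pi * a)) : ℂ)) * (2 * (2 * Real.pi * a)))) * Complex.exp (((2 * Real.pi * a : ℝ) : ℂ) * (1 / 4 : ℝ))) * Complex.exp (-((2 * Real.pi * a : ℝ)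 : ℂ) * y)) *
        Complex.exp (((((2 * Real.pi * (ξ + a * s) : ℝ)) : ℂ)) * y * Complex.I))) := by fun_prop
    rw [intervalIntegrable_iff_integrableOn_Ioo_of_le (by norm_num)]
    exact (hc.integrableOn_Icc.mono_set Ioo_subset_Icc_self).congr_fun hEq.symm measurableSet_Ioo
  have P1 : IntervalIntegrable F volume (-(1 / 4 : ℝ)) (1 / 4 : ℝ) := by
    have hEq : EqOn F (fun y : ℝ => (1 : ℂ) * ((((1 : ℂ) * (-1 / ((1 - starRingEnd ℂ (Complex.exp (2 * Real.pi * β * Complex.I)) * (Real.exp (-(2 * Real.pi * a)) : ℂ)) * (2 * (2 * Real.pi * a)))) * Complex.exp (-((2 * Real.pi * a : ℝ) : ℂ) * (1 / 4 : ℝ))) * Complex.exp (((2 * Real.pi * a : ℝ) : ℂ) * y) + ((1 : ℂ) * (-(Complex.exp (2 * Real.pi * β * Complex.I) * (Real.exp (-(2 * Real.pi * a)) : ℂ)) / ((1 - Complex.exp (2 * Real.pi * β * Complex.I) * (Real.exp (-(2 * Real.pi * a)) : ℂ)) * (2 * (2 * Real.pi * a)))) * Complex.exp (((2 * Real.pi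 * a : ℝ) : ℂ) * (1 / 4 : ℝ))) * Complex.exp (-((2 * Real.pi * a : ℝ) : ℂ) * y)) *
        Complex.exp (((((2 * Real.pi * (ξ - a * s) : ℝ)) : ℂ)) * y * Complex.I))) (Ioo (-(1 / 4 : ℝ)) (1 / 4 : ℝ)) := fun y hy => by
      simp only [hF]; exact forcingIntegrand_quarter_centre ha β ξ s hK hG hy
    have hc : Continuous (fun y : ℝ => (1 : ℂ) * ((((1 : ℂ) * (-1 / ((1 - starRingEnd ℂ (Complex.exp (2 * Real.pi * β * Complex.I)) * (Real.exp (-(2 * Real.pi * a)) : ℂ)) * (2 * (2 * Real.pi * a)))) * Complex.exp (-((2 * Real.pi * a : ℝ) : ℂ) * (1 / 4 : ℝ))) * Complex.exp (((2 * Real.pi * a : ℝ) : ℂ) * y) + ((1 : ℂ) * (-(Complex.exp (2 * Real.pi * β * Complex.I) * (Real.exp (-(2 * Real.pi * a)) : ℂ)) / ((1 - Complex.exp (2 * Real.pi * β * Complex.I) * (Real.exp (-(2 * Real.pi * a)) : ℂ)) * (2 * (2 * Real.pi * a)))) * Complex.exp (((2 * Real.pi * a : ℝ) : ℂ) * (1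 / 4 : ℝ))) * Complex.exp (-((2 * Real.pi * a : ℝ) : ℂ) * y)) *
        Complex.exp (((((2 * Real.pi * (ξ - a * s) : ℝ)) : ℂ)) * y * Complex.I))) := by fun_prop
    rw [intervalIntegrable_iff_integrableOn_Ioo_of_le (by norm_num)]
    exact (hc.integrableOn_Icc.mono_set Ioo_subset_Icc_self).congr_fun hEq.symm measurableSet_Ioo
  have P2 : IntervalIntegrable F volume (1 / 4 : ℝ) (1 / 2 : ℝ) := by
    have hEq : EqOn F (fun y : ℝ => Complex.exp (-((Real.pi * a * s : ℝ) : ℂ) * Complex.I) * ((((starRingEnd ℂ (Complex.exp (2 * Real.pi * β * Complex.I))) * (-1 / ((1 - starRingEnd ℂ (Complex.exp (2 * Real.pi * β * Complex.I)) * (Real.exp (-(2 * Real.pi * a)) : ℂ)) * (2 * (2 * Real.pi * a)))) * Complex.exp (-((2 * Real.pi * a : ℝ) : ℂ) * (5 / 4 : ℝ))) * Complex.exp (((2 * Real.pi * a : ℝ) : ℂ) * y) + ((starRingEnd ℂ (Complex.exp (2 * Real.pi * β * Complex.I))) * (-(Complex.exp (2 * Real.pi * β * Complex.I) * (Real.exp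 (-(2 * Real.pi * a)) : ℂ)) / ((1 - Complex.exp (2 * Real.pi * β * Complex.I) * (Real.exp (-(2 * Real.pi * a)) : ℂ)) * (2 * (2 * Real.pi * a)))) * Complex.exp (((2 * Real.pi * a : ℝ) : ℂ) * (5 / 4 : ℝ))) * Complex.exp (-((2 * Real.pi * a : ℝ) : ℂ) * y)) *
        Complex.exp (((((2 * Real.pi * (ξ + a * s) : ℝ)) : ℂ)) * y * Complex.I))) (Ioo (1 / 4 : ℝ) (1 / 2 : ℝ)) := fun y hy => by
      simp only [hF]; exact forcingIntegrand_quarter_crest ha β ξ s hK hG hy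
    have hc : Continuous (fun y : ℝ => Complex.exp (-((Real.pi * a * s : ℝ) : ℂ) * Complex.I) * ((((starRingEnd ℂ (Complex.exp (2 * Real.pi * β * Complex.I))) * (-1 / ((1 - starRingEnd ℂ (Complex.exp (2 * Real.pi * β * Complex.I)) * (Real.exp (-(2 * Real.pi * a)) : ℂ)) * (2 * (2 * Real.pi * a)))) * Complex.exp (-((2 * Real.pi * a : ℝ) : ℂ) * (5 / 4 : ℝ))) * Complex.exp (((2 * Real.pi * a : ℝ) : ℂ) * y) + ((starRingEnd ℂ (Complex.exp (2 * Real.pi * β * Complex.I))) * (-(Complex.exp (2 * Real.pi * β * Complex.I) * (Real.exp (-(2 * Real.pi * a)) : ℂ)) / ((1 - Complex.exp (2 * Real.pi * β * Complex.I) * (Real.exp (-(2 * Real.pi * a)) : ℂ)) * (2 * (2 * Real.pi * a)))) * Complex.exp (((2 * Real.pi * a : ℝ) : ℂ) * (5 / 4 : ℝ))) * Complex.exp (-((2 * Real.pi * a : ℝ) : ℂ) * y)) *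
        Complex.exp (((((2 * Real.pi * (ξ + a * s) : ℝ)) : ℂ)) * y * Complex.I))) := by fun_prop
    rw [intervalIntegrable_iff_integrableOn_Ioo_of_le (by norm_num)]
    exact (hc.integrableOn_Icc.mono_set Ioo_subset_Icc_self).congr_fun hEq.symm measurableSet_Ioo
  exact P0.trans (P1.trans P2)


/-- The single-mode forcing integrand at the kink line `y₀ = −¼` is interval integrable on `[−½, ½]` (piecewise equal on the open pieces to
continuous functions, `…KHForcingPieces`). [cite: Drazin2002, §8.3 (8.36)–(8.38)] -/
theorem forcingIntegrand_intervalIntegrable_negQuarter (ha : 0 < a) (β ξ s : ℝ)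
    (hK : K = fun r : ℝ => (-((Real.exp (-(2 * Real.pi * a * r)) : ℂ) /
            (1 - starRingEnd ℂ (Complex.exp (2 * Real.pi * β * Complex.I)) * (Real.exp (-(2 * Real.pi * a)) : ℂ))
          + (Real.exp (2 * Real.pi * a * (r - 1)) : ℂ) * Complex.exp (2 * Real.pi * β * Complex.I) /
            (1 - Complex.exp (2 * Real.pi * β * Complex.I) * (Real.exp (-(2 * Real.pi * a)) : ℂ))) /
        (2 * (2 * Real.pi * a) : ℂ)))
    (hG : ∀ u : ℝ, G u = Complex.exp (2 * Real.pi * β * (⌊u⌋ : ℝ) * Complex.I) * K (u - ⌊u⌋)) :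
    IntervalIntegrable (fun y : ℝ => G ((-(1 / 4 : ℝ)) - y) * Complex.exp (((2 * Real.pi * ξ * y : ℝ) : ℂ) * Complex.I) * Complex.exp (-((2 * Real.pi * a * s * triWave y : ℝ) : ℂ) * Complex.I)) volume (-(1 / 2 : ℝ)) (1 / 2 : ℝ) := by
  set F : ℝ → ℂ := fun y => G ((-(1 / 4 : ℝ)) - y) * Complex.exp (((2 * Real.pi * ξ * y : ℝ) : ℂ) * Complex.I) * Complex.exp (-((2 * Real.pi * a * s * triWave y : ℝ) : ℂ) * Complex.I) with hF
  have P0 : IntervalIntegrable F volume (-(1 / 2 : ℝ)) (-(1 / 4 : ℝ)) := by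
    have hEq : EqOn F (fun y : ℝ => Complex.exp (((Real.pi * a * s : ℝ) : ℂ) * Complex.I) * ((((1 : ℂ) * (-1 / ((1 - starRingEnd ℂ (Complex.exp (2 * Real.pi * β * Complex.I)) * (Real.exp (-(2 * Real.pi * a)) : ℂ)) * (2 * (2 * Real.pi * a)))) * Complex.exp (-((2 * Real.pi * a : ℝ) : ℂ) * (-(1 / 4 : ℝ)))) * Complex.exp (((2 * Real.pi * a : ℝ) : ℂ) * y) + ((1 : ℂ) * (-(Complex.exp (2 * Real.pi * β * Complex.I) * (Real.exp (-(2 * Real.pi * a)) : ℂ)) / ((1 - Complex.exp (2 * Real.pi * β * Complex.I) * (Real.exp (-(2 * Real.pi * a)) : ℂ)) * (2 * (2 * Real.pi * a)))) * Complex.exp (((2 * Real.pi * a : ℝ) : ℂ) * (-(1 / 4 : ℝ)))) * Complex.exp (-((2 * Real.pi * a : ℝ) : ℂ) * y)) *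
        Complex.exp (((((2 * Real.pi * (ξ + a * s) : ℝ)) : ℂ)) * y * Complex.I))) (Ioo (-(1 / 2 : ℝ)) (-(1 / 4 : ℝ))) := fun y hy => by
      simp only [hF]; exact forcingIntegrand_negQuarter_trough ha β ξ s hK hG hy
    have hc : Continuous (fun y : ℝ => Complex.exp (((Real.pi * a * s : ℝ) : ℂ) * Complex.I) * ((((1 : ℂ) * (-1 / ((1 - starRingEnd ℂ (Complex.exp (2 * Real.pi * β * Complex.I)) * (Real.exp (-(2 * Real.pi * a)) : ℂ)) * (2 * (2 * Real.pi * a)))) * Complex.exp (-((2 * Real.pi * a : ℝ) : ℂ) * (-(1 / 4 : ℝ)))) * Complex.exp (((2 * Real.pi * a : ℝ) : ℂ) * y) + ((1 : ℂ) * (-(Complex.exp (2 * Real.pi * β * Complex.I) * (Real.exp (-(2 * Real.pi * a)) : ℂ)) / ((1 - Complex.exp (2 * Real.pi * β * Complex.I) * (Real.exp (-(2 * Real.pi * a)) : ℂ)) * (2 * (2 * Real.pi * a)))) * Complex.exp (((2 * Real.pi * a : ℝ) : ℂ) * (-(1 / 4 : ℝ)))) * Complex.exp (-((2 * Real.pi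 * a : ℝ) : ℂ) * y)) *
        Complex.exp (((((2 * Real.pi * (ξ + a * s) : ℝ)) : ℂ)) * y * Complex.I))) := by fun_prop
    rw [intervalIntegrable_iff_integrableOn_Ioo_of_le (by norm_num)]
    exact (hc.integrableOn_Icc.mono_set Ioo_subset_Icc_self).congr_fun hEq.symm measurableSet_Ioo
  have P1 : IntervalIntegrable F volume (-(1 / 4 : ℝ)) (1 / 4 : ℝ) := by
    have hEq : EqOn F (fun y : ℝ => (1 : ℂ) * ((((starRingEnd ℂ (Complex.exp (2 * Real.pi * β * Complex.I))) * (-1 / ((1 - starRingEnd ℂ (Complex.exp (2 * Real.pi * β * Complex.I)) * (Real.exp (-(2 * Real.pi * a)) : ℂ)) * (2 * (2 * Real.pi * a)))) * Complex.exp (-((2 * Real.pi * a : ℝ) : ℂ) * (3 / 4 : ℝ))) * Complex.exp (((2 * Real.pi * a : ℝ) : ℂ) * y) + ((starRingEnd ℂ (Complex.exp (2 * Real.pi * β * Complex.I))) * (-(Complex.exp (2 * Real.pi * β * Complex.I) * (Real.exp (-(2 * Real.pi * a)) : ℂ)) / ((1 - Complex.exp (2 * Real.pi * β * Complex.I) *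 (Real.exp (-(2 * Real.pi * a)) : ℂ)) * (2 * (2 * Real.pi * a)))) * Complex.exp (((2 * Real.pi * a : ℝ) : ℂ) * (3 / 4 : ℝ))) * Complex.exp (-((2 * Real.pi * a : ℝ) : ℂ) * y)) *
        Complex.exp (((((2 * Real.pi * (ξ - a * s) : ℝ)) : ℂ)) * y * Complex.I))) (Ioo (-(1 / 4 : ℝ)) (1 / 4 : ℝ)) := fun y hy => by
      simp only [hF]; exact forcingIntegrand_negQuarter_centre ha β ξ s hK hG hy
    have hc : Continuous (fun y : ℝ => (1 : ℂ) * ((((starRingEnd ℂ (Complex.exp (2 * Real.pi * β * Complex.I))) * (-1 / ((1 - starRingEnd ℂ (Complex.exp (2 * Real.pi * β * Complex.I)) * (Real.exp (-(2 * Real.pi * a)) : ℂ)) * (2 * (2 * Real.pi * a)))) * Complex.exp (-((2 * Real.pi * a : ℝ) : ℂ) * (3 / 4 : ℝ))) * Complex.exp (((2 * Real.pi * a : ℝ) : ℂ) * y) + ((starRingEnd ℂ (Complex.exp (2 * Real.pi * β * Complex.I))) * (-(Complex.exp (2 * Real.pi * β * Complex.I) * (Real.exp (-(2 * Real.pi *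 a)) : ℂ)) / ((1 - Complex.exp (2 * Real.pi * β * Complex.I) * (Real.exp (-(2 * Real.pi * a)) : ℂ)) * (2 * (2 * Real.pi * a)))) * Complex.exp (((2 * Real.pi * a : ℝ) : ℂ) * (3 / 4 : ℝ))) * Complex.exp (-((2 * Real.pi * a : ℝ) : ℂ) * y)) *
        Complex.exp (((((2 * Real.pi * (ξ - a * s) : ℝ)) : ℂ)) * y * Complex.I))) := by fun_prop
    rw [intervalIntegrable_iff_integrableOn_Ioo_of_le (by norm_num)]
    exact (hc.integrableOn_Icc.mono_set Ioo_subset_Icc_self).congr_fun hEq.symm measurableSet_Ioo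
  have P2 : IntervalIntegrable F volume (1 / 4 : ℝ) (1 / 2 : ℝ) := by
    have hEq : EqOn F (fun y : ℝ => Complex.exp (-((Real.pi * a * s : ℝ) : ℂ) * Complex.I) * ((((starRingEnd ℂ (Complex.exp (2 * Real.pi * β * Complex.I))) * (-1 / ((1 - starRingEnd ℂ (Complex.exp (2 * Real.pi * β * Complex.I)) * (Real.exp (-(2 * Real.pi * a)) : ℂ)) * (2 * (2 * Real.pi * a)))) * Complex.exp (-((2 * Real.pi * a : ℝ) : ℂ) * (3 / 4 : ℝ))) * Complex.exp (((2 * Real.pi * a : ℝ) : ℂ) * y) + ((starRingEnd ℂ (Complex.exp (2 * Real.pi * β * Complex.I))) * (-(Complex.exp (2 * Real.pi * β * Complex.I) * (Real.exp (-(2 * Real.pi * a)) : ℂ)) / ((1 - Complex.exp (2 * Real.pi * β * Complex.I) * (Real.exp (-(2 * Real.pi * a)) : ℂ)) * (2 * (2 * Real.pi * a)))) * Complex.exp (((2 * Real.pi * a : ℝ) : ℂ) * (3 / 4 : ℝ))) * Complex.exp (-((2 * Real.pi * a : ℝ) : ℂ) * y)) *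
        Complex.exp (((((2 * Real.pi * (ξ + a * s) : ℝ)) : ℂ)) * y * Complex.I))) (Ioo (1 / 4 : ℝ) (1 / 2 : ℝ)) := fun y hy => by
      simp only [hF]; exact forcingIntegrand_negQuarter_crest ha β ξ s hK hG hy
    have hc : Continuous (fun y : ℝ => Complex.exp (-((Real.pi * a * s : ℝ) : ℂ) * Complex.I) * ((((starRingEnd ℂ (Complex.exp (2 * Real.pi * β * Complex.I))) * (-1 / ((1 - starRingEnd ℂ (Complex.exp (2 * Real.pi * β * Complex.I)) * (Real.exp (-(2 * Real.pi * a)) : ℂ)) * (2 * (2 * Real.pi * a)))) * Complex.exp (-((2 * Real.pi * a : ℝ) : ℂ) * (3 / 4 : ℝ))) * Complex.exp (((2 * Real.pi * a : ℝ) : ℂ) * y) + ((starRingEnd ℂ (Complex.exp (2 * Real.pi * β * Complex.I))) * (-(Complex.exp (2 * Real.pi * β * Complex.I) * (Real.exp (-(2 * Real.pi * a)) : ℂ)) / ((1 - Complex.exp (2 * Real.pi * β * Complex.I) * (Real.exp (-(2 * Real.pi * a)) : ℂ)) * (2 * (2 * Real.pi * a)))) * Complex.exp (((2 * Real.pi *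 a : ℝ) : ℂ) * (3 / 4 : ℝ))) * Complex.exp (-((2 * Real.pi * a : ℝ) : ℂ) * y)) *
        Complex.exp (((((2 * Real.pi * (ξ + a * s) : ℝ)) : ℂ)) * y * Complex.I))) := by fun_prop
    rw [intervalIntegrable_iff_integrableOn_Ioo_of_le (by norm_num)]
    exact (hc.integrableOn_Icc.mono_set Ioo_subset_Icc_self).congr_fun hEq.symm measurableSet_Ioo
  exact P0.trans (P1.trans P2)

/-- **Linearity over a finite mode profile:** for `y₀ ∈ {¼, −¼}`, a finite set of modes `S` and coefficients `c`,
`∫_{−½}^{½} G(y₀−y)·(Σ_{n∈S} c n e^{2πi(β+n)y})·e^{−2πiasT(y)} dy = Σ_{n∈S} c n ∫_{−½}^{½} G(y₀−y) e^{2πi(β+n)y} e^{−2πiasT(y)} dy`.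
[cite: Drazin2002, §8.3 (8.36)–(8.38)] -/
theorem integral_forcing_finset_sum (ha : 0 < a) (β s : ℝ)
    (hK : K = fun r : ℝ => (-((Real.exp (-(2 * Real.pi * a * r)) : ℂ) /
            (1 - starRingEnd ℂ (Complex.exp (2 * Real.pi * β * Complex.I)) * (Real.exp (-(2 * Real.pi * a)) : ℂ))
          + (Real.exp (2 * Real.pi * a * (r - 1)) : ℂ) * Complex.exp (2 * Real.pi * β * Complex.I) /
            (1 - Complex.exp (2 * Real.pi * β * Complex.I) * (Real.exp (-(2 * Real.pi * a)) : ℂ))) /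
        (2 * (2 * Real.pi * a) : ℂ)))
    (hG : ∀ u : ℝ, G u = Complex.exp (2 * Real.pi * β * (⌊u⌋ : ℝ) * Complex.I) * K (u - ⌊u⌋))
    {y₀ : ℝ} (hy₀ : y₀ = 1 / 4 ∨ y₀ = -(1 / 4)) (S : Finset ℤ) (c : ℤ → ℂ) :
    ∫ y in (-(1 / 2 : ℝ))..(1 / 2 : ℝ), G (y₀ - y) * (∑ n ∈ S, c n * Complex.exp (((2 * Real.pi * (β + n) * y : ℝ) : ℂ) * Complex.I)) *
        Complex.exp (-((2 * Real.pi * a * s * triWave y : ℝ) : ℂ) * Complex.I) =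
      ∑ n ∈ S, c n * ∫ y in (-(1 / 2 : ℝ))..(1 / 2 : ℝ), G (y₀ - y) * Complex.exp (((2 * Real.pi * (β + n) * y : ℝ) : ℂ) * Complex.I) *
        Complex.exp (-((2 * Real.pi * a * s * triWave y : ℝ) : ℂ) * Complex.I) := by
  have hint : ∀ n ∈ S, IntervalIntegrable (fun y : ℝ => c n * (G (y₀ - y) * Complex.exp (((2 * Real.pi * (β + n) * y : ℝ) : ℂ) * Complex.I) *
      Complex.exp (-((2 * Real.pi * a * s * triWave y : ℝ) : ℂ) * Complex.I))) volume (-(1 / 2 : ℝ)) (1 / 2 : ℝ) := by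
    intro n _
    rcases hy₀ with h | h <;> subst h
    · exact (forcingIntegrand_intervalIntegrable_quarter ha β (β + n) s hK hG).const_mul _
    · exact (forcingIntegrand_intervalIntegrable_negQuarter ha β (β + n) s hK hG).const_mul _
  have hpt : ∀ y : ℝ, G (y₀ - y) * (∑ n ∈ S, c n * Complex.exp (((2 * Real.pi * (β + n) * y : ℝ) : ℂ) * Complex.I)) *
      Complex.exp (-((2 * Real.pi * a * s * triWave y : ℝ) : ℂ) * Complex.I) =
      ∑ n ∈ S, c n * (G (y₀ - y) * Complex.exp (((2 * Real.pi * (β + n) * y : ℝ) : ℂ) * Complex.I) *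
        Complex.exp (-((2 * Real.pi * a * s * triWave y : ℝ) : ℂ) * Complex.I)) := by
    intro y
    rw [Finset.mul_sum, Finset.sum_mul]
    refine Finset.sum_congr rfl fun n _ => ?_
    ring
  simp_rw [hpt]
  rw [intervalIntegral.integral_finsetSum hint]
  refine Finset.sum_congr rfl fun n _ => ?_
  exact intervalIntegral.integral_const_mul _ _

end modes

end Summit.AnomalousDissipation.AnomalousDissipation.Theorems.SawtoothPulseCascade.K2PhaseBudget

end
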